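import Summits.Ventures.PercRepro.C041TriangleSeedCorner2
import Summits.Ventures.PercRepro.C041TriangleSeedCell4
import Summits.Ventures.PercRepro.C041TriangleSeedCell5
import Summits.Ventures.PercRepro.C041TriangleSeedCell6
import Summits.Ventures.PercRepro.C041TriangleSeedCell7
import Summits.Ventures.PercRepro.C041TriangleSeedCell8

/-!
# THE MARK AGAINST EVERY STAR WITH AT LEAST FOUR LEAVES IN `[1/12, 1/4]` (mine-3, gen 63; C-041.md §21 (ax))

The five cells `m = 4, …, 8` (`C041TriangleSeedCell4` … `Cell8`, each its own region-fitted certificate) and the infinite family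
`m ≥ 9` (`C041TriangleSeedCorner2`) assemble into one statement: `θ_△(v 1, V a) ∈ cone` for every star `a : Fin m → ℝ` with
`4 ≤ m` leaves all in `[1/12, 1/4]` (`InCone_thetaTri_v1_tiny_all`).  Nothing is fitted here; the proof is a case split on `m`.
-/

namespace PercRepro

namespace RelaxedTriangle

open TreeClosure

/-- **THEOREM (THE MARK AGAINST EVERY STAR OF `m ≥ 4` LEAVES IN `[1/12, 1/4]`)**: `θ_△(v 1, V a) ∈ cone`. -/
theorem InCone_thetaTri_v1_tiny_all {m : ℕ} (hm : 4 ≤ m) (a : Fin m → ℝ) (ha : ∀ i, 1 / 12 ≤ a i ∧ a i ≤ 1 / 4) :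
    InCone (thetaTri (v 1) (V a)) := by
  rcases Nat.lt_or_ge m 9 with h | h
  · interval_cases m
    · exact InCone_thetaTri_v1_tiny4 a ha
    · exact InCone_thetaTri_v1_tiny5 a ha
    · exact InCone_thetaTri_v1_tiny6 a ha
    · exact InCone_thetaTri_v1_tiny7 a ha
    · exact InCone_thetaTri_v1_tiny8 a ha
  · exact InCone_thetaTri_v1_tiny h a ha

end RelaxedTriangle

end PercRepro
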